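import Summits.NavierStokesRegularity.NavierStokesRegularity.Theorems.CorkscrewDynamoSphereTangentLiouvilleHodgeTools
import HarnessLib

/-!
# A sphere-Hodge lemma on `(EuclideanSpace ℝ (Fin 3))`, II: tangent, divergence-free, radially curl-free fields vanish

Support file for item `stmt-NavierStokesRegularity-1365` (`SphereTangentLiouville`, route
`CorkscrewDynamo`, NavierStokesRegularity); continues
`CorkscrewDynamoSphereTangentLiouvilleHodgeTools.lean`. A `C²` vector field `V` on `(EuclideanSpace ℝ (Fin 3))` which is
tangent to the spheres about the origin (`⟪x, V x⟫ = 0`), divergence free, and whose curl is also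
tangent to those spheres (`⟪x, curl V x⟫ = 0`) vanishes identically — on each sphere `V` is a
harmonic tangent field of `S²`. Proof by a weighted Bochner identity on the whole space:

* `frobeniusNormSq_fderiv_eq` — `|DV|² = tr(DV DV) + ‖curl V‖²`;
* `integral_radial_frobenius_defect_eq_zero` — `∫ η(|x|²)(|x|²|DV(x)|² − ‖DV(x) x‖²) dx = 0`
  for every compactly supported `C¹` profile `η`;
* `norm_sq_le_frobenius_defect` — pointwise `‖V x‖² ≤ |x|²|DV(x)|² − ‖DV(x)x‖²` (orthonormal
  frame adapted to `x`);
* `eq_zero_of_tangent_of_divFree_of_inner_curl_eq_zero` — the lemma (`∫ η(|x|²)‖V‖² ≤ 0`).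
-/

noncomputable section

open MeasureTheory Set Function Filter InnerProductSpace
open scoped RealInnerProductSpace Topology
open Literature.Analysis Literature.Analysis.FluidPDE

set_option linter.dupNamespace false

namespace Summit.NavierStokesRegularity.NavierStokesRegularity.Theorems

/-! ### The Bochner identity and the pointwise bound -/

section Bochner

/-- **`|DV|² = tr(DV DV) + ‖curl V‖²`** pointwise on `(EuclideanSpace ℝ (Fin 3))` (`‖curl‖² = ½|DV − DVᵀ|²` and
`|L − Lᵀ|² = 2(|L|² − tr(L L))`). -/
theorem frobeniusNormSq_fderiv_eq (V : (EuclideanSpace ℝ (Fin 3)) → (EuclideanSpace ℝ (Fin 3))) {x : (EuclideanSpace ℝ (Fin 3))} (hV : DifferentiableAt ℝ V x) :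
    frobeniusNormSq (fderiv ℝ V x) =
      traceCLM ((fderiv ℝ V x).comp (fderiv ℝ V x)) + ‖curl V x‖ ^ 2 := by
  have h1 := norm_curl_sq_eq_frobeniusNormSq_spin_holds V x hV
  have h2 := frobeniusNormSq_sub_adjoint (fderiv ℝ V x)
  rw [spin] at h1
  rw [h1, h2]
  ring

/-- `D(‖V‖²)(x) h = 2⟪V x, DV(x) h⟫`. -/
theorem fderiv_norm_sq_apply {E : Type*} [NormedAddCommGroup E] [InnerProductSpace ℝ E]
    {V : E → E} {x : E} (hV : DifferentiableAt ℝ V x) (h : E) :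
    fderiv ℝ (fun y => ‖V y‖ ^ 2) x h = 2 * ⟪V x, fderiv ℝ V x h⟫ := by
  rw [hV.hasFDerivAt.norm_sq.fderiv]
  simp

/-- **The weighted Bochner identity.** For a `C²` divergence-free field `V` on `(EuclideanSpace ℝ (Fin 3))` tangent to
the spheres about the origin, with `curl V` tangent to them as well, and every compactly supported
`C¹` profile `η`: `∫ η(|x|²) (|x|² |DV(x)|² − ‖DV(x) x‖²) dx = 0`. (On each sphere this is
`∫ |∇_tan V|² = ∫ (div_S V)² + (curl_S V)² − K|V|² + K|V|² = 0`.) Proof: pointwise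
`|x|²|DV|² − ‖DV x‖² = |x|² tr(DV DV) + D(‖V‖²)[x] + ‖V‖²` (`frobeniusNormSq_fderiv_eq`,
`norm_curl_sq_mul_norm_sq_of_tangent`), and the three integrals are `∫ 2(η + |x|²η')‖V‖²`,
`−∫ (3η + 2|x|²η')‖V‖²`, `∫ η‖V‖²` (`integral_radial_mul_traceCLM` with `ψ(s) = s η(s)`,
`integral_radial_fderiv_norm_sq`), which cancel. -/
theorem integral_radial_frobenius_defect_eq_zero {V : (EuclideanSpace ℝ (Fin 3)) → (EuclideanSpace ℝ (Fin 3))} (hV : ContDiff ℝ 2 V)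
    (hdiv : VectorCalculus.IsDivFree V) (hT : ∀ x, ⟪x, V x⟫ = 0) (hC : ∀ x, ⟪x, curl V x⟫ = 0)
    {η : ℝ → ℝ} (hη : ContDiff ℝ 1 η) (hηc : HasCompactSupport η) :
    ∫ x, η (‖x‖ ^ 2) * (‖x‖ ^ 2 * frobeniusNormSq (fderiv ℝ V x) - ‖fderiv ℝ V x x‖ ^ 2) = 0 := by
  have hV1 : ContDiff ℝ 1 V := hV.of_le one_le_two
  have hVd : ∀ x, DifferentiableAt ℝ V x := fun x => hV1.differentiable one_ne_zero x
  -- the profile `ψ(s) = s η(s)`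
  have hψ : ContDiff ℝ 1 fun s : ℝ => s * η s := contDiff_id.mul hη
  have hψc : HasCompactSupport fun s : ℝ => s * η s := hηc.mul_left
  have hψ' : ∀ s : ℝ, deriv (fun s : ℝ => s * η s) s = η s + s * deriv η s := by
    intro s
    rw [deriv_fun_mul differentiableAt_fun_id ((hη.differentiable one_ne_zero) s), deriv_id'']
    ring
  have A := integral_radial_mul_traceCLM hV hdiv hT hψ hψc
  have B := integral_radial_fderiv_norm_sq hV1 hη hηc
  simp only [hψ', finrank_euclideanSpace_fin, Nat.cast_ofNat] at A B
  -- pointwise identity for the integrand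
  have hpt : ∀ x : (EuclideanSpace ℝ (Fin 3)), η (‖x‖ ^ 2) * (‖x‖ ^ 2 * frobeniusNormSq (fderiv ℝ V x) - ‖fderiv ℝ V x x‖ ^ 2) =
      (‖x‖ ^ 2 * η (‖x‖ ^ 2)) * traceCLM ((fderiv ℝ V x).comp (fderiv ℝ V x)) +
        η (‖x‖ ^ 2) * fderiv ℝ (fun y => ‖V y‖ ^ 2) x x + η (‖x‖ ^ 2) * ‖V x‖ ^ 2 := by
    intro x
    have h1 := frobeniusNormSq_fderiv_eq V (hVd x)
    have h2 := norm_curl_sq_mul_norm_sq_of_tangent hT (hVd x) (hC x)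
    have h3 : ‖fderiv ℝ V x x + V x‖ ^ 2 =
        ‖fderiv ℝ V x x‖ ^ 2 + 2 * ⟪fderiv ℝ V x x, V x⟫ + ‖V x‖ ^ 2 :=
      norm_add_sq_real _ _
    have h4 : ‖x‖ ^ 2 * ‖curl V x‖ ^ 2 =
        ‖fderiv ℝ V x x‖ ^ 2 + 2 * ⟪fderiv ℝ V x x, V x⟫ + ‖V x‖ ^ 2 := by
      rw [mul_comm, h2, h3]
    rw [fderiv_norm_sq_apply (hVd x), real_inner_comm, h1]
    linear_combination (η (‖x‖ ^ 2)) * h4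
  -- integrability of the three pieces (continuous, compactly supported)
  have hηc' : HasCompactSupport fun x : (EuclideanSpace ℝ (Fin 3)) => η (‖x‖ ^ 2) := hasCompactSupport_comp_norm_sq hηc
  have hcη : Continuous fun x : (EuclideanSpace ℝ (Fin 3)) => η (‖x‖ ^ 2) := (contDiff_comp_norm_sq hη).continuous
  have hcD : Continuous fun x : (EuclideanSpace ℝ (Fin 3)) => fderiv ℝ V x := hV1.continuous_fderiv one_ne_zero
  have hc1 : Continuous fun x : (EuclideanSpace ℝ (Fin 3)) =>
      (‖x‖ ^ 2 * η (‖x‖ ^ 2)) * traceCLM ((fderiv ℝ V x).comp (fderiv ℝ V x)) :=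
    ((continuous_norm.pow 2).mul hcη).mul (traceCLM.continuous.comp (hcD.clm_comp hcD))
  have hi1 : Integrable fun x : (EuclideanSpace ℝ (Fin 3)) =>
      (‖x‖ ^ 2 * η (‖x‖ ^ 2)) * traceCLM ((fderiv ℝ V x).comp (fderiv ℝ V x)) := by
    refine hc1.integrable_of_hasCompactSupport (hηc'.mono fun x hx => ?_)
    simp only [mem_support, ne_eq, mul_eq_zero, not_or] at hx ⊢
    exact hx.1.2
  have hc2 : Continuous fun x : (EuclideanSpace ℝ (Fin 3)) => η (‖x‖ ^ 2) * fderiv ℝ (fun y => ‖V y‖ ^ 2) x x :=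
    hcη.mul (((hV1.norm_sq ℝ).continuous_fderiv one_ne_zero).clm_apply continuous_id)
  have hi2 : Integrable fun x : (EuclideanSpace ℝ (Fin 3)) => η (‖x‖ ^ 2) * fderiv ℝ (fun y => ‖V y‖ ^ 2) x x := by
    refine hc2.integrable_of_hasCompactSupport (hηc'.mono fun x hx => ?_)
    simp only [mem_support, ne_eq, mul_eq_zero, not_or] at hx ⊢
    exact hx.1
  have hc3 : Continuous fun x : (EuclideanSpace ℝ (Fin 3)) => η (‖x‖ ^ 2) * ‖V x‖ ^ 2 :=
    hcη.mul (hV.continuous.norm.pow 2)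
  have hi3 : Integrable fun x : (EuclideanSpace ℝ (Fin 3)) => η (‖x‖ ^ 2) * ‖V x‖ ^ 2 := by
    refine hc3.integrable_of_hasCompactSupport (hηc'.mono fun x hx => ?_)
    simp only [mem_support, ne_eq, mul_eq_zero, not_or] at hx ⊢
    exact hx.1
  have hηdc : HasCompactSupport fun x : (EuclideanSpace ℝ (Fin 3)) => deriv η (‖x‖ ^ 2) :=
    hasCompactSupport_comp_norm_sq hηc.deriv
  have hcη' : Continuous fun x : (EuclideanSpace ℝ (Fin 3)) => deriv η (‖x‖ ^ 2) :=
    (hη.continuous_deriv le_rfl).comp (continuous_norm.pow 2)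
  have hK : IsCompact (tsupport (fun x : (EuclideanSpace ℝ (Fin 3)) => η (‖x‖ ^ 2)) ∪
      tsupport fun x : (EuclideanSpace ℝ (Fin 3)) => deriv η (‖x‖ ^ 2)) := hηc'.isCompact.union hηdc.isCompact
  have hvan : ∀ x : (EuclideanSpace ℝ (Fin 3)), x ∉ tsupport (fun x : (EuclideanSpace ℝ (Fin 3)) => η (‖x‖ ^ 2)) ∪
      tsupport (fun x : (EuclideanSpace ℝ (Fin 3)) => deriv η (‖x‖ ^ 2)) → η (‖x‖ ^ 2) = 0 ∧ deriv η (‖x‖ ^ 2) = 0 := by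
    intro x hx
    simp only [mem_union, not_or] at hx
    exact ⟨image_eq_zero_of_notMem_tsupport (f := fun x : (EuclideanSpace ℝ (Fin 3)) => η (‖x‖ ^ 2)) hx.1,
      image_eq_zero_of_notMem_tsupport (f := fun x : (EuclideanSpace ℝ (Fin 3)) => deriv η (‖x‖ ^ 2)) hx.2⟩
  have hc4 : Continuous fun x : (EuclideanSpace ℝ (Fin 3)) =>
      2 * (η (‖x‖ ^ 2) + ‖x‖ ^ 2 * deriv η (‖x‖ ^ 2)) * ‖V x‖ ^ 2 :=
    (continuous_const.mul (hcη.add ((continuous_norm.pow 2).mul hcη'))).mul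
      (hV.continuous.norm.pow 2)
  have hi4 : Integrable fun x : (EuclideanSpace ℝ (Fin 3)) =>
      2 * (η (‖x‖ ^ 2) + ‖x‖ ^ 2 * deriv η (‖x‖ ^ 2)) * ‖V x‖ ^ 2 := by
    refine hc4.integrable_of_hasCompactSupport
      (HasCompactSupport.of_support_subset_isCompact hK fun x hx => ?_)
    by_contra hx'
    obtain ⟨e1, e2⟩ := hvan x hx'
    simp [e1, e2] at hx
  have hc5 : Continuous fun x : (EuclideanSpace ℝ (Fin 3)) =>
      (3 * η (‖x‖ ^ 2) + 2 * ‖x‖ ^ 2 * deriv η (‖x‖ ^ 2)) * ‖V x‖ ^ 2 :=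
    ((continuous_const.mul hcη).add
      ((continuous_const.mul (continuous_norm.pow 2)).mul hcη')).mul (hV.continuous.norm.pow 2)
  have hi5 : Integrable fun x : (EuclideanSpace ℝ (Fin 3)) =>
      (3 * η (‖x‖ ^ 2) + 2 * ‖x‖ ^ 2 * deriv η (‖x‖ ^ 2)) * ‖V x‖ ^ 2 := by
    refine hc5.integrable_of_hasCompactSupport
      (HasCompactSupport.of_support_subset_isCompact hK fun x hx => ?_)
    by_contra hx'
    obtain ⟨e1, e2⟩ := hvan x hx'
    simp [e1, e2] at hx
  -- assemble
  have step1 : ∫ x, η (‖x‖ ^ 2) * (‖x‖ ^ 2 * frobeniusNormSq (fderiv ℝ V x) - ‖fderiv ℝ V x x‖ ^ 2) =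
      (∫ x, (‖x‖ ^ 2 * η (‖x‖ ^ 2)) * traceCLM ((fderiv ℝ V x).comp (fderiv ℝ V x))) +
        (∫ x, η (‖x‖ ^ 2) * fderiv ℝ (fun y => ‖V y‖ ^ 2) x x) +
        ∫ x, η (‖x‖ ^ 2) * ‖V x‖ ^ 2 := by
    rw [integral_congr_ae (Eventually.of_forall hpt), integral_add ?_ hi3, integral_add hi1 hi2]
    exact hi1.add hi2
  have step2 : (∫ x : (EuclideanSpace ℝ (Fin 3)), 2 * (η (‖x‖ ^ 2) + ‖x‖ ^ 2 * deriv η (‖x‖ ^ 2)) * ‖V x‖ ^ 2) +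
      -(∫ x : (EuclideanSpace ℝ (Fin 3)), (3 * η (‖x‖ ^ 2) + 2 * ‖x‖ ^ 2 * deriv η (‖x‖ ^ 2)) * ‖V x‖ ^ 2) +
      (∫ x : (EuclideanSpace ℝ (Fin 3)), η (‖x‖ ^ 2) * ‖V x‖ ^ 2) =
      ∫ x : (EuclideanSpace ℝ (Fin 3)), (2 * (η (‖x‖ ^ 2) + ‖x‖ ^ 2 * deriv η (‖x‖ ^ 2)) * ‖V x‖ ^ 2 -
        (3 * η (‖x‖ ^ 2) + 2 * ‖x‖ ^ 2 * deriv η (‖x‖ ^ 2)) * ‖V x‖ ^ 2 +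
        η (‖x‖ ^ 2) * ‖V x‖ ^ 2) := by
    rw [integral_add ?_ hi3, integral_sub hi4 hi5]
    · ring
    · exact hi4.sub hi5
  rw [step1, A, B, step2]
  refine integral_eq_zero_of_ae (Eventually.of_forall fun x => ?_)
  simp only [Pi.zero_apply]
  ring

/-- **Pointwise lower bound**: for a field `V` tangent to the spheres about the origin and
differentiable at `x`, `‖V x‖² ≤ |x|² |DV(x)|² − ‖DV(x) x‖²`. (In an orthonormal frame
`(x̂, e₁, e₂)`: `|DV|² ≥ ‖DV x̂‖² + ⟪x̂, DV e₁⟫² + ⟪x̂, DV e₂⟫²`, and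
`⟪x̂, DV eⱼ⟫ = −⟪eⱼ, V⟫/|x|` with `⟪x̂, V⟫ = 0`.) -/
theorem norm_sq_le_frobenius_defect {V : (EuclideanSpace ℝ (Fin 3)) → (EuclideanSpace ℝ (Fin 3))} (hT : ∀ x, ⟪x, V x⟫ = 0)
    {x : (EuclideanSpace ℝ (Fin 3))} (hV : DifferentiableAt ℝ V x) :
    ‖V x‖ ^ 2 ≤ ‖x‖ ^ 2 * frobeniusNormSq (fderiv ℝ V x) - ‖fderiv ℝ V x x‖ ^ 2 := by
  by_cases hx : x = 0
  · subst hx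
    have h0 : V 0 = 0 := apply_zero_eq_zero_of_tangent hT hV
    simp [h0]
  -- an orthonormal frame adapted to `x`
  set L := fderiv ℝ V x with hL
  set u : (EuclideanSpace ℝ (Fin 3)) := ‖x‖⁻¹ • x with hu
  have hxn : 0 < ‖x‖ := norm_pos_iff.2 hx
  have hun : ‖u‖ = 1 := by rw [hu]; exact norm_smul_inv_norm hx
  have horth : Orthonormal ℝ (({0} : Set (Fin 3)).restrict fun _ : Fin 3 => u) := by
    refine orthonormal_iff_ite.2 fun i j => ?_
    have hij : i = j := Subsingleton.elim i j
    subst hij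
    simp only [restrict_apply, if_true]
    rw [real_inner_self_eq_norm_sq, hun, one_pow]
  obtain ⟨b, hb⟩ := Orthonormal.exists_orthonormalBasis_extension_of_card_eq (𝕜 := ℝ) (E := (EuclideanSpace ℝ (Fin 3)))
    (by simp) horth
  have hb0 : b 0 = u := hb 0 rfl
  -- matrix entries in the frame
  have hfrob := frobeniusNormSq_eq_sum_sum_sq_inner b L
  have hLu : ‖L u‖ ^ 2 = ∑ i, ⟪b i, L (b 0)⟫ ^ 2 := by rw [hb0, b.sum_sq_inner_right]
  have hV2 : ‖V x‖ ^ 2 = ∑ i, ⟪b i, V x⟫ ^ 2 := (b.sum_sq_inner_right (V x)).symm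
  have hrow : ∀ j, ⟪b 0, L (b j)⟫ = -‖x‖⁻¹ * ⟪b j, V x⟫ := by
    intro j
    rw [hb0, hu, real_inner_smul_left, hL, inner_fderiv_apply_of_tangent hT hV]
    ring
  have h00 : ⟪b 0, V x⟫ = 0 := by
    rw [hb0, hu, real_inner_smul_left, hT x, mul_zero]
  have hLx : ‖L x‖ ^ 2 = ‖x‖ ^ 2 * ‖L u‖ ^ 2 := by
    have : x = ‖x‖ • u := by rw [hu, smul_smul, mul_inv_cancel₀ hxn.ne', one_smul]
    conv_lhs => rw [this]
    rw [map_smul, norm_smul, Real.norm_of_nonneg hxn.le]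
    ring
  rw [hfrob, hLx, hLu, hV2]
  simp only [Fin.sum_univ_three, hrow, h00] at *
  have hxinv : ‖x‖ ^ 2 * ‖x‖⁻¹ ^ 2 = 1 := by field_simp
  nlinarith [sq_nonneg ⟪b 1, L (b 1)⟫, sq_nonneg ⟪b 1, L (b 2)⟫, sq_nonneg ⟪b 2, L (b 1)⟫,
    sq_nonneg ⟪b 2, L (b 2)⟫, sq_nonneg ⟪b 1, V x⟫, sq_nonneg ⟪b 2, V x⟫,
    sq_nonneg ‖x‖, hxinv, sq_nonneg (⟪b 0, L (b 0)⟫), sq_nonneg ⟪b 1, L (b 0)⟫,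
    sq_nonneg ⟪b 2, L (b 0)⟫]

/-- **The sphere-Hodge lemma.** A `C²` vector field on `(EuclideanSpace ℝ (Fin 3))` which is tangent to the spheres about
the origin, divergence free, and whose curl is tangent to those spheres, vanishes identically:
by the Bochner identity and the pointwise bound, `∫ η(|x|²) ‖V x‖² dx ≤ 0` for every nonnegative
compactly supported smooth profile `η`. -/
theorem eq_zero_of_tangent_of_divFree_of_inner_curl_eq_zero {V : (EuclideanSpace ℝ (Fin 3)) → (EuclideanSpace ℝ (Fin 3))} (hV : ContDiff ℝ 2 V)
    (hT : ∀ x, ⟪x, V x⟫ = 0) (hdiv : VectorCalculus.IsDivFree V) (hC : ∀ x, ⟪x, curl V x⟫ = 0) :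
    V = 0 := by
  have hV1 : ContDiff ℝ 1 V := hV.of_le one_le_two
  have hVd : ∀ x, DifferentiableAt ℝ V x := fun x => hV1.differentiable one_ne_zero x
  -- for every radius, a smooth nonnegative profile equal to one on `[-R, R]`
  suffices key : ∀ R : ℝ, 0 < R → ∀ x : (EuclideanSpace ℝ (Fin 3)), ‖x‖ ^ 2 < R → V x = 0 by
    funext x
    exact key (‖x‖ ^ 2 + 1) (by positivity) x (by linarith)
  intro R hR x hxR
  let η : ContDiffBump (0 : ℝ) := ⟨R, R + 1, hR, by linarith⟩
  have hη : ContDiff ℝ 1 η := η.contDiff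
  have hηc : HasCompactSupport η := η.hasCompactSupport
  have hI := integral_radial_frobenius_defect_eq_zero hV hdiv hT hC hη hηc
  -- the integrand dominates `η(|x|²) ‖V x‖² ≥ 0`
  set F : (EuclideanSpace ℝ (Fin 3)) → ℝ := fun y => η (‖y‖ ^ 2) * ‖V y‖ ^ 2 with hF
  set G : (EuclideanSpace ℝ (Fin 3)) → ℝ := fun y =>
    η (‖y‖ ^ 2) * (‖y‖ ^ 2 * frobeniusNormSq (fderiv ℝ V y) - ‖fderiv ℝ V y y‖ ^ 2) with hG
  have hFG : ∀ y, F y ≤ G y := fun y =>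
    mul_le_mul_of_nonneg_left (norm_sq_le_frobenius_defect hT (hVd y)) (η.nonneg' _)
  have hF0 : ∀ y, 0 ≤ F y := fun y => mul_nonneg (η.nonneg' _) (sq_nonneg _)
  have hηc' : HasCompactSupport fun y : (EuclideanSpace ℝ (Fin 3)) => η (‖y‖ ^ 2) := hasCompactSupport_comp_norm_sq hηc
  have hcη : Continuous fun y : (EuclideanSpace ℝ (Fin 3)) => η (‖y‖ ^ 2) := (contDiff_comp_norm_sq hη).continuous
  have hFc : Continuous F := hcη.mul (hV.continuous.norm.pow 2)
  have hFi : Integrable F := by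
    refine hFc.integrable_of_hasCompactSupport (hηc'.mono fun y hy => ?_)
    simp only [hF, mem_support, ne_eq, mul_eq_zero, not_or] at hy ⊢
    exact hy.1
  have hcD : Continuous fun y : (EuclideanSpace ℝ (Fin 3)) => fderiv ℝ V y := hV1.continuous_fderiv one_ne_zero
  have hGc : Continuous G := by
    refine hcη.mul (((continuous_norm.pow 2).mul ?_).sub ((hcD.clm_apply continuous_id).norm.pow 2))
    simp only [frobeniusNormSq]
    exact continuous_finsetSum _ fun i _ => (hcD.clm_apply continuous_const).norm.pow 2
  have hGi : Integrable G := by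
    refine hGc.integrable_of_hasCompactSupport (hηc'.mono fun y hy => ?_)
    simp only [hG, mem_support, ne_eq, mul_eq_zero, not_or] at hy ⊢
    exact hy.1
  have hIF : ∫ y, F y = 0 := by
    have h1 : ∫ y, F y ≤ ∫ y, G y := integral_mono hFi hGi hFG
    have h2 : 0 ≤ ∫ y, F y := integral_nonneg hF0
    have h3 : ∫ y, G y = 0 := hI
    linarith
  have hFae : F =ᵐ[volume] 0 := (integral_eq_zero_iff_of_nonneg hF0 hFi).1 hIF
  have hF0' : F = 0 := (Continuous.ae_eq_iff_eq volume hFc continuous_const).1 hFae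
  have hFx : F x = 0 := congrFun hF0' x
  have hηx : η (‖x‖ ^ 2) = 1 := by
    apply η.one_of_mem_closedBall
    rw [Metric.mem_closedBall, dist_zero_right, Real.norm_eq_abs, abs_of_nonneg (sq_nonneg _)]
    exact hxR.le
  simp only [hF, hηx, one_mul] at hFx
  exact norm_eq_zero.1 (pow_eq_zero_iff two_ne_zero |>.1 hFx)

end Bochner

end Summit.NavierStokesRegularity.NavierStokesRegularity.Theorems
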